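import Mathlib
import HarnessLib

/-!
# Complex structures of Weil type = polarizing planes (van Geemen 5.5–5.7; Deligne's `X⁺`)

Let `V` be a complex vector space and `H` a Hermitian form on `V` (sesquilinear, conjugate-linear
in the FIRST variable — Mathlib's `V →ₗ⋆[ℂ] V →ₗ[ℂ] ℂ` with `LinearMap.IsSymm`), and put
`E := Im H`, so that `Re H(x, y) = E(x, iy)` and `H(x, y) = E(x, iy) + i E(x, y)` (van Geemen,
LNM 1594, 5.5–5.6). This is the setting of the period domain of abelian varieties of Weil type:
for `K = ℚ(√-d)` acting on `V_ℚ` with a `K`-Hermitian form `H` (loc. cit. 5.2–5.3),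
`V := V_ℚ ⊗ ℝ` is a complex vector space for `i := √-d ⊗ 1/√d` (5.5), the `K`-linear real
endomorphisms of `V` are exactly its `ℂ`-linear maps, and `E = Im H` is the polarization.

A **complex structure of Weil type** for `(V, H)` (`IsWeilComplexStructure H J`) is a `ℂ`-linear
(= `K`-linear) `J` with `J² = -1` satisfying the RIEMANN RELATIONS `E(Jx, Jy) = E(x, y)` and
`E(x, Jx) > 0` for `x ≠ 0` (5.6) — a point of Deligne's `X⁺` (LNM 900, proof of Thm. 4.8, p. 49:
the `E`-linear complex structures `J` on `V(ℝ)` with `ψ(Jx, Jy) = ψ(x, y)` and `ψ(x, Jy)`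
positive definite symmetric). A **polarizing plane** (`IsPolarizingPlane H W`) is a complex
subspace `W = V₊ ⊆ V` with `H|_W > 0` and `H|_{W^⊥} < 0` (5.5: "`H` is positive definite on `V₊`
and therefore negative definite on `V₋ := V₊^⊥`"). MAIN RESULTS (all proved, no named facts):

* `isCompl_orthogonalBilin_of_isPosDefOn`: `V = W ⊕ W^⊥` for `W` positive definite and `V`
  finite-dimensional (definiteness + a rank count);
* `isWeilComplexStructure_complexStructureOfPlane` (van Geemen 5.6): `J_W := i` on `W`, `-i` on
  `W^⊥` is a complex structure of Weil type; it is even `H`-unitary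
  (`apply_complexStructureOfPlane`), and its `i`-eigenspace is `W`
  (`eigenspace_complexStructureOfPlane`);
* conversely, for `J` of Weil type, `W := ker(J - i)` is a polarizing plane
  (`IsWeilComplexStructure.isPolarizingPlane_eigenspace`), `W^⊥ = ker(J + i)`
  (`IsWeilComplexStructure.orthogonalBilin_eigenspace`), and `J = J_W`
  (`IsWeilComplexStructure.complexStructureOfPlane_eigenspace`);
* `weilComplexStructureEquiv`: `{J // IsWeilComplexStructure H J} ≃ {W // IsPolarizingPlane H W}`
  — Deligne's `X⁺` IS van Geemen's `H_n = {W : H|_W > 0}` (5.8–5.10), the Grassmannian model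
  whose unitary-frame coordinates form the bounded domain of `Motives/UnitaryPeriodDomain`.

The type of `J` (multiplicities of the `K`-action on `V^{1,0} = ker(J - i) ⊕ conj(ker(J + i))`)
is `(dim W, dim W^⊥)` (5.7).

## Not here

Signature bookkeeping (`dim W = p ⟺ W^⊥` negative definite, for `H` of signature `(p, q)`), the
topology of `X⁺`, the base change from the `ℚ`-datum of `Motives/WeilHermitianWitt`, lattices and
the quotient tori (5.7), `SU(n, n)`-transitivity (5.10).

## References

* [vanGeemen1994HodgeAV] B. van Geemen, *An introduction to the Hodge conjecture for abelian
  varieties*, LNM 1594 (1994), 5.5, 5.6, 5.7, 5.8.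
* [Deligne1982HodgeCycles] P. Deligne, *Hodge cycles on abelian varieties*, LNM 900, proof of
  Thm. 4.8, p. 49 (the domain `X⁺`).
-/

noncomputable section

open Module
open scoped ComplexConjugate

namespace Literature.AlgebraicGeometry.Motives

variable {V : Type*} [AddCommGroup V] [Module ℂ V]

section Defs

variable (H : V →ₗ⋆[ℂ] V →ₗ[ℂ] ℂ)

/-- `H` is positive definite on the subspace `W`: `Re H(x, x) > 0` for `0 ≠ x ∈ W` (for `H`
Hermitian `H(x, x)` is real, `apply_self_im`). [cite: vanGeemen1994HodgeAV, 5.5] -/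
def IsPosDefOn (W : Submodule ℂ V) : Prop :=
  ∀ x ∈ W, x ≠ 0 → 0 < (H x x).re

/-- `H` is negative definite on the subspace `W`. [cite: vanGeemen1994HodgeAV, 5.5] -/
def IsNegDefOn (W : Submodule ℂ V) : Prop :=
  ∀ x ∈ W, x ≠ 0 → (H x x).re < 0

/-- A **polarizing plane** `W = V₊`: `H|_W > 0` and `H` negative definite on the `H`-orthogonal
complement `W^⊥ = {v | ∀ w ∈ W, H(w, v) = 0}` (`Submodule.orthogonalBilin H W`).
[cite: vanGeemen1994HodgeAV, 5.5] -/
def IsPolarizingPlane (W : Submodule ℂ V) : Prop :=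
  IsPosDefOn H W ∧ IsNegDefOn H (Submodule.orthogonalBilin H W)

/-- A **complex structure of Weil type** for `(V, H)`: a `ℂ`-linear (= `K`-linear) `J` with
`J² = -1` satisfying the Riemann relations for `E = Im H`: `E(Jx, Jy) = E(x, y)` and
`E(x, Jx) > 0` for `x ≠ 0` — a point of Deligne's domain `X⁺`.
[cite: vanGeemen1994HodgeAV, 5.6] [cite: Deligne1982HodgeCycles, proof of Thm. 4.8, p. 49] -/
structure IsWeilComplexStructure (J : V →ₗ[ℂ] V) : Prop where
  /-- `J² = -1`. -/
  sq : ∀ x, J (J x) = -x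
  /-- First Riemann relation `E(Jx, Jy) = E(x, y)`. -/
  compat : ∀ x y, (H (J x) (J y)).im = (H x y).im
  /-- Second Riemann relation `E(x, Jx) > 0` for `x ≠ 0`. -/
  pos : ∀ x, x ≠ 0 → 0 < (H x (J x)).im

variable {H}

/-- The component `x₊ ∈ W` of `x` in `V = W ⊕ W^⊥`. [cite: vanGeemen1994HodgeAV, 5.5–5.6] -/
def weilPlusPart {W : Submodule ℂ V} (h : IsCompl W (Submodule.orthogonalBilin H W)) : V →ₗ[ℂ] V :=
  W.projection _ h

/-- The component `x₋ ∈ W^⊥` of `x` in `V = W ⊕ W^⊥`. [cite: vanGeemen1994HodgeAV, 5.5–5.6] -/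
def weilMinusPart {W : Submodule ℂ V} (h : IsCompl W (Submodule.orthogonalBilin H W)) : V →ₗ[ℂ] V :=
  (Submodule.orthogonalBilin H W).projection _ h.symm

/-- **van Geemen's complex structure `J_{V₊}`**: `J x = i x₊ - i x₋` for `V = W ⊕ W^⊥`.
[cite: vanGeemen1994HodgeAV, 5.5] -/
def complexStructureOfPlane (W : Submodule ℂ V) (h : IsCompl W (Submodule.orthogonalBilin H W)) :
    V →ₗ[ℂ] V :=
  Complex.I • weilPlusPart h - Complex.I • weilMinusPart h

end Defs

variable {H : V →ₗ⋆[ℂ] V →ₗ[ℂ] ℂ}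

/-! ### Sesquilinear bookkeeping -/

/-- `H(c x, y) = c̄ H(x, y)`. [folklore] -/
theorem sesq_smul_left (H : V →ₗ⋆[ℂ] V →ₗ[ℂ] ℂ) (c : ℂ) (x y : V) :
    H (c • x) y = conj c * H x y := by
  rw [map_smulₛₗ, LinearMap.smul_apply, smul_eq_mul]

/-- `H(x, c y) = c H(x, y)`. [folklore] -/
theorem sesq_smul_right (H : V →ₗ⋆[ℂ] V →ₗ[ℂ] ℂ) (c : ℂ) (x y : V) :
    H x (c • y) = c * H x y := by
  rw [map_smul, smul_eq_mul]

/-- Members of `W` and of `W^⊥` are `H`-orthogonal. [folklore] -/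
theorem apply_eq_zero_of_mem_of_mem_orthogonalBilin (H : V →ₗ⋆[ℂ] V →ₗ[ℂ] ℂ) {W : Submodule ℂ V}
    {x y : V} (hx : x ∈ W) (hy : y ∈ Submodule.orthogonalBilin H W) : H x y = 0 :=
  Submodule.mem_orthogonalBilin_iff.1 hy x hx

/-- … in the other order, for `H` Hermitian. [folklore] -/
theorem apply_eq_zero_of_mem_orthogonalBilin_of_mem (hH : H.IsSymm) {W : Submodule ℂ V}
    {x y : V} (hx : x ∈ Submodule.orthogonalBilin H W) (hy : y ∈ W) : H x y = 0 := by
  rw [← hH.eq, apply_eq_zero_of_mem_of_mem_orthogonalBilin H hy hx, map_zero]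

/-- `H(x, x)` is real for `H` Hermitian. [folklore] -/
theorem apply_self_im (hH : H.IsSymm) (x : V) : (H x x).im = 0 :=
  Complex.conj_eq_iff_im.1 (hH.eq x x)

/-! ### `V = W ⊕ W^⊥` for `W` positive definite -/

section FiniteDimensional

variable [FiniteDimensional ℂ V]

/-- Rank count: `dim V ≤ dim W + dim W^⊥` (`W^⊥` contains the kernel of `v ↦ (H(bᵢ, v))ᵢ` for a
basis `(bᵢ)` of `W`). [folklore] -/
theorem finrank_le_finrank_add_finrank_orthogonalBilin (H : V →ₗ⋆[ℂ] V →ₗ[ℂ] ℂ)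
    (W : Submodule ℂ V) :
    finrank ℂ V ≤ finrank ℂ W + finrank ℂ (Submodule.orthogonalBilin H W) := by
  let b := Module.finBasis ℂ W
  let φ : V →ₗ[ℂ] (Fin (finrank ℂ W) → ℂ) := LinearMap.pi fun i => H (b i : V)
  have hker : LinearMap.ker φ ≤ Submodule.orthogonalBilin H W := by
    intro v hv
    rw [LinearMap.mem_ker] at hv
    have hvi : ∀ i, H (b i : V) v = 0 := fun i => by
      simpa [φ] using congrFun hv i
    rw [Submodule.mem_orthogonalBilin_iff]
    intro w hw
    have hw' : (w : V) = ∑ i, b.repr ⟨w, hw⟩ i • (b i : V) := by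
      have h := congrArg W.subtype (b.sum_repr ⟨w, hw⟩)
      rw [map_sum] at h
      simp only [map_smul, Submodule.subtype_apply] at h
      exact h.symm
    rw [hw', map_sum, LinearMap.sum_apply]
    refine Finset.sum_eq_zero fun i _ => ?_
    rw [sesq_smul_left, hvi, mul_zero]
  have hrange : finrank ℂ (LinearMap.range φ) ≤ finrank ℂ W :=
    (Submodule.finrank_le _).trans (Module.finrank_fin_fun ℂ).le
  have h := LinearMap.finrank_range_add_finrank_ker φ
  have hk := Submodule.finrank_mono hker
  omega

/-- **`V = W ⊕ W^⊥` for `W` positive definite** (definiteness gives `W ∩ W^⊥ = 0`, the rank count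
the rest). [cite: vanGeemen1994HodgeAV, 5.5 ("`V_ℝ = V₊ ⊕ V₋`")] -/
theorem isCompl_orthogonalBilin_of_isPosDefOn {W : Submodule ℂ V} (hW : IsPosDefOn H W) :
    IsCompl W (Submodule.orthogonalBilin H W) := by
  refine (Submodule.isCompl_iff_disjoint W _
    (finrank_le_finrank_add_finrank_orthogonalBilin H W)).2 ?_
  rw [Submodule.disjoint_def]
  intro x hx hx'
  by_contra hne
  have h0 : H x x = 0 := apply_eq_zero_of_mem_of_mem_orthogonalBilin H hx hx'
  have h := hW x hx hne
  rw [h0, Complex.zero_re] at h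
  exact lt_irrefl _ h

end FiniteDimensional

/-! ### van Geemen 5.6: `J_W` is a complex structure of Weil type -/

section OfPlane

variable {W : Submodule ℂ V} (h : IsCompl W (Submodule.orthogonalBilin H W))

/-- `x = x₊ + x₋`. [cite: vanGeemen1994HodgeAV, 5.6] -/
theorem weilPlusPart_add_weilMinusPart (x : V) : weilPlusPart h x + weilMinusPart h x = x :=
  Submodule.projection_add_projection_eq_self h x

/-- `x₊ ∈ W`. [cite: vanGeemen1994HodgeAV, 5.6] -/
theorem weilPlusPart_mem (x : V) : weilPlusPart h x ∈ W :=
  Submodule.projection_apply_mem h x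

/-- `x₋ ∈ W^⊥`. [cite: vanGeemen1994HodgeAV, 5.6] -/
theorem weilMinusPart_mem (x : V) : weilMinusPart h x ∈ Submodule.orthogonalBilin H W :=
  Submodule.projection_apply_mem h.symm x

/-- `x₊ = x` for `x ∈ W`. [cite: vanGeemen1994HodgeAV, 5.6] -/
theorem weilPlusPart_eq_self {x : V} (hx : x ∈ W) : weilPlusPart h x = x :=
  (Submodule.projection_eq_self_iff h x).2 hx

/-- `x₋ = 0` for `x ∈ W`. [cite: vanGeemen1994HodgeAV, 5.6] -/
theorem weilMinusPart_eq_zero {x : V} (hx : x ∈ W) : weilMinusPart h x = 0 :=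
  (Submodule.projection_apply_eq_zero_iff h.symm).2 hx

/-- `x₊ = 0` for `x ∈ W^⊥`. [cite: vanGeemen1994HodgeAV, 5.6] -/
theorem weilPlusPart_eq_zero {x : V} (hx : x ∈ Submodule.orthogonalBilin H W) : weilPlusPart h x = 0 :=
  (Submodule.projection_apply_eq_zero_iff h).2 hx

/-- `x₋ = x` for `x ∈ W^⊥`. [cite: vanGeemen1994HodgeAV, 5.6] -/
theorem weilMinusPart_eq_self {x : V} (hx : x ∈ Submodule.orthogonalBilin H W) : weilMinusPart h x = x :=
  (Submodule.projection_eq_self_iff h.symm x).2 hx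

/-- `x₋ = 0 ↔ x ∈ W`. [cite: vanGeemen1994HodgeAV, 5.6] -/
theorem weilMinusPart_eq_zero_iff {x : V} : weilMinusPart h x = 0 ↔ x ∈ W :=
  Submodule.projection_apply_eq_zero_iff h.symm

/-- `H(x₊, y₋) = 0`. [cite: vanGeemen1994HodgeAV, 5.6 ("`V₊ ⊥ V₋`")] -/
theorem apply_weilPlusPart_weilMinusPart (x y : V) : H (weilPlusPart h x) (weilMinusPart h y) = 0 :=
  apply_eq_zero_of_mem_of_mem_orthogonalBilin H (weilPlusPart_mem h x) (weilMinusPart_mem h y)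

/-- `H(x₋, y₊) = 0` (`H` Hermitian). [cite: vanGeemen1994HodgeAV, 5.6 ("`V₊ ⊥ V₋`")] -/
theorem apply_weilMinusPart_weilPlusPart (hH : H.IsSymm) (x y : V) : H (weilMinusPart h x) (weilPlusPart h y) = 0 :=
  apply_eq_zero_of_mem_orthogonalBilin_of_mem hH (weilMinusPart_mem h x) (weilPlusPart_mem h y)

/-- `H(x, y) = H(x₊, y₊) + H(x₋, y₋)` (`H` Hermitian). [cite: vanGeemen1994HodgeAV, 5.6] -/
theorem apply_eq_weilPlusPart_add_weilMinusPart (hH : H.IsSymm) (x y : V) :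
    H x y = H (weilPlusPart h x) (weilPlusPart h y) + H (weilMinusPart h x) (weilMinusPart h y) := by
  conv_lhs => rw [← weilPlusPart_add_weilMinusPart h x, ← weilPlusPart_add_weilMinusPart h y]
  rw [map_add H, LinearMap.add_apply, map_add, map_add, apply_weilPlusPart_weilMinusPart h,
    apply_weilMinusPart_weilPlusPart h hH, add_zero, zero_add]

/-- `J_W x = i x₊ - i x₋`. [cite: vanGeemen1994HodgeAV, 5.5] -/
theorem complexStructureOfPlane_apply (x : V) :
    complexStructureOfPlane W h x = Complex.I • weilPlusPart h x - Complex.I • weilMinusPart h x :=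
  rfl

/-- `J_W = i` on `W`. [cite: vanGeemen1994HodgeAV, 5.5] -/
theorem complexStructureOfPlane_apply_of_mem {x : V} (hx : x ∈ W) :
    complexStructureOfPlane W h x = Complex.I • x := by
  rw [complexStructureOfPlane_apply, weilPlusPart_eq_self h hx, weilMinusPart_eq_zero h hx, smul_zero,
    sub_zero]

/-- `J_W = -i` on `W^⊥`. [cite: vanGeemen1994HodgeAV, 5.5] -/
theorem complexStructureOfPlane_apply_of_mem_orthogonalBilin {x : V}
    (hx : x ∈ Submodule.orthogonalBilin H W) :
    complexStructureOfPlane W h x = -(Complex.I • x) := by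
  rw [complexStructureOfPlane_apply, weilPlusPart_eq_zero h hx, weilMinusPart_eq_self h hx, smul_zero,
    zero_sub]

/-- `J_W² = -1`. [cite: vanGeemen1994HodgeAV, 5.5 ("Clearly `J² = -I`")] -/
theorem complexStructureOfPlane_sq (x : V) :
    complexStructureOfPlane W h (complexStructureOfPlane W h x) = -x := by
  conv_lhs => rw [complexStructureOfPlane_apply h x]
  rw [map_sub, map_smul, map_smul, complexStructureOfPlane_apply_of_mem h (weilPlusPart_mem h x),
    complexStructureOfPlane_apply_of_mem_orthogonalBilin h (weilMinusPart_mem h x), smul_neg, smul_smul,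
    smul_smul, Complex.I_mul_I, neg_smul, one_smul, neg_smul, one_smul, sub_neg_eq_add,
    ← neg_add, weilPlusPart_add_weilMinusPart h x]

/-- **`J_W` is `H`-unitary**: `H(J_W x, J_W y) = H(x, y)` (cross terms vanish by orthogonality).
[cite: vanGeemen1994HodgeAV, 5.6 (first Riemann relation)] -/
theorem apply_complexStructureOfPlane (hH : H.IsSymm) (x y : V) :
    H (complexStructureOfPlane W h x) (complexStructureOfPlane W h y) = H x y := by
  have hII : ∀ z : ℂ, Complex.I * (-Complex.I * z) = z := fun z => by
    rw [← mul_assoc, mul_neg, Complex.I_mul_I, neg_neg, one_mul]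
  rw [apply_eq_weilPlusPart_add_weilMinusPart h hH x y, complexStructureOfPlane_apply,
    complexStructureOfPlane_apply]
  simp only [map_sub, LinearMap.sub_apply, sesq_smul_left, sesq_smul_right,
    apply_weilPlusPart_weilMinusPart h, apply_weilMinusPart_weilPlusPart h hH, Complex.conj_I, mul_zero, sub_zero,
    zero_sub, hII, sub_neg_eq_add]

/-- `E(x, J_W x) = Re H(x₊, x₊) - Re H(x₋, x₋)`. [cite: vanGeemen1994HodgeAV, 5.6 (display)] -/
theorem im_apply_self_complexStructureOfPlane (hH : H.IsSymm) (x : V) :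
    (H x (complexStructureOfPlane W h x)).im =
      (H (weilPlusPart h x) (weilPlusPart h x)).re - (H (weilMinusPart h x) (weilMinusPart h x)).re := by
  have hx : H x = H (weilPlusPart h x + weilMinusPart h x) := by rw [weilPlusPart_add_weilMinusPart h x]
  rw [complexStructureOfPlane_apply, hx, map_add H, LinearMap.add_apply, map_sub, map_sub,
    sesq_smul_right, sesq_smul_right, sesq_smul_right, sesq_smul_right, apply_weilPlusPart_weilMinusPart h,
    apply_weilMinusPart_weilPlusPart h hH]
  simp only [mul_zero, sub_zero, zero_sub, Complex.add_im, Complex.neg_im, Complex.I_mul_im]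
  ring

/-- **van Geemen 5.6**: for a polarizing plane `W`, `J_W` is a complex structure of Weil type
(`E(Jx, Jy) = E(x, y)` and `E(x, Jx) = H(x₊, x₊) - H(x₋, x₋) > 0`).
[cite: vanGeemen1994HodgeAV, 5.6] -/
theorem isWeilComplexStructure_complexStructureOfPlane (hH : H.IsSymm)
    (hW : IsPolarizingPlane H W) : IsWeilComplexStructure H (complexStructureOfPlane W h) where
  sq := complexStructureOfPlane_sq h
  compat x y := by rw [apply_complexStructureOfPlane h hH]
  pos x hx := by
    rw [im_apply_self_complexStructureOfPlane h hH]
    have hP0 : 0 ≤ (H (weilPlusPart h x) (weilPlusPart h x)).re := by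
      rcases eq_or_ne (weilPlusPart h x) 0 with h0 | h0
      · simp [h0]
      · exact (hW.1 _ (weilPlusPart_mem h x) h0).le
    have hQ0 : (H (weilMinusPart h x) (weilMinusPart h x)).re ≤ 0 := by
      rcases eq_or_ne (weilMinusPart h x) 0 with h0 | h0
      · simp [h0]
      · exact (hW.2 _ (weilMinusPart_mem h x) h0).le
    rcases eq_or_ne (weilPlusPart h x) 0 with hP | hP
    · have hQ : weilMinusPart h x ≠ 0 := by
        intro hQ
        apply hx
        rw [← weilPlusPart_add_weilMinusPart h x, hP, hQ, add_zero]
      have hlt := hW.2 _ (weilMinusPart_mem h x) hQ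
      linarith
    · have hlt := hW.1 _ (weilPlusPart_mem h x) hP
      linarith

/-- The `i`-eigenspace of `J_W` is `W`. [cite: vanGeemen1994HodgeAV, 5.5 and 5.7] -/
theorem eigenspace_complexStructureOfPlane :
    Module.End.eigenspace (complexStructureOfPlane W h) Complex.I = W := by
  ext x
  rw [Module.End.mem_eigenspace_iff]
  constructor
  · intro hx
    have h1 := congrArg (weilMinusPart h) hx
    rw [complexStructureOfPlane_apply, map_sub, map_smul, map_smul, map_smul,
      weilMinusPart_eq_zero h (weilPlusPart_mem h x), weilMinusPart_eq_self h (weilMinusPart_mem h x), smul_zero,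
      zero_sub] at h1
    have h2 : ((2 : ℂ) * Complex.I) • weilMinusPart h x = 0 := by
      rw [mul_smul, two_smul]
      nth_rewrite 1 [← h1]
      exact neg_add_cancel _
    rcases smul_eq_zero.1 h2 with h3 | h3
    · exact absurd h3 (mul_ne_zero two_ne_zero Complex.I_ne_zero)
    · exact (weilMinusPart_eq_zero_iff h).1 h3
  · intro hx
    exact complexStructureOfPlane_apply_of_mem h hx

end OfPlane

/-! ### Converse: a complex structure of Weil type comes from its `i`-eigenspace -/

namespace IsWeilComplexStructure

variable {J : V →ₗ[ℂ] V}

/-- `x₊ := ½(x - iJx) ∈ ker(J - i)`. [cite: vanGeemen1994HodgeAV, 5.7] -/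
theorem half_sub_mem_eigenspace (hJ : IsWeilComplexStructure H J) (x : V) :
    (2⁻¹ : ℂ) • (x - Complex.I • J x) ∈ Module.End.eigenspace J Complex.I := by
  rw [Module.End.mem_eigenspace_iff]
  have h2 : J (x - Complex.I • J x) = Complex.I • (x - Complex.I • J x) := by
    rw [map_sub, map_smul, hJ.sq, smul_sub, smul_smul, Complex.I_mul_I, neg_one_smul, smul_neg]
    abel
  rw [map_smul, h2]
  exact smul_comm _ _ _

/-- `x₋ := ½(x + iJx) ∈ ker(J + i)`. [cite: vanGeemen1994HodgeAV, 5.7] -/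
theorem half_add_mem_eigenspace_neg (hJ : IsWeilComplexStructure H J) (x : V) :
    (2⁻¹ : ℂ) • (x + Complex.I • J x) ∈ Module.End.eigenspace J (-Complex.I) := by
  rw [Module.End.mem_eigenspace_iff]
  have h2 : J (x + Complex.I • J x) = (-Complex.I) • (x + Complex.I • J x) := by
    rw [map_add, map_smul, hJ.sq, neg_smul, smul_add, smul_smul, Complex.I_mul_I, neg_one_smul,
      smul_neg]
    abel
  rw [map_smul, h2]
  exact smul_comm _ _ _

/-- `x = ½(x - iJx) + ½(x + iJx)`. [folklore] -/
theorem half_sub_add_half_add (J : V →ₗ[ℂ] V) (x : V) :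
    (2⁻¹ : ℂ) • (x - Complex.I • J x) + (2⁻¹ : ℂ) • (x + Complex.I • J x) = x := by
  module

/-- **`ker(J - i) ⊥ ker(J + i)`**: from `E(Jx, Jy) = E(x, y)` applied to `(x, y)` and `(x, iy)`.
[cite: vanGeemen1994HodgeAV, 5.6] [cite: Deligne1982HodgeCycles, proof of Thm. 4.8, p. 49] -/
theorem apply_eq_zero_of_mem_eigenspace (hJ : IsWeilComplexStructure H J) {x y : V}
    (hx : x ∈ Module.End.eigenspace J Complex.I) (hy : y ∈ Module.End.eigenspace J (-Complex.I)) :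
    H x y = 0 := by
  rw [Module.End.mem_eigenspace_iff] at hx hy
  have hIy : J (Complex.I • y) = y := by
    rw [map_smul, hy, smul_smul, mul_neg, Complex.I_mul_I, neg_neg, one_smul]
  have h1 := hJ.compat x y
  rw [hx, hy, sesq_smul_left, sesq_smul_right, Complex.conj_I] at h1
  have h2 := hJ.compat x (Complex.I • y)
  rw [hx, hIy, sesq_smul_left, sesq_smul_right, Complex.conj_I] at h2
  have him : (H x y).im = 0 := by
    have h3 : -Complex.I * (-Complex.I * H x y) = -H x y := by
      rw [← mul_assoc, neg_mul_neg, Complex.I_mul_I, neg_one_mul]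
    rw [h3, Complex.neg_im] at h1
    linarith
  have hre : (H x y).re = 0 := by
    simp only [neg_mul, Complex.neg_im, Complex.I_mul_im] at h2
    linarith
  exact Complex.ext hre him

/-- `H` is positive definite on `ker(J - i)`: `E(x, Jx) = E(x, ix) = Re H(x, x)`.
[cite: vanGeemen1994HodgeAV, 5.6–5.7] -/
theorem isPosDefOn_eigenspace (hJ : IsWeilComplexStructure H J) :
    IsPosDefOn H (Module.End.eigenspace J Complex.I) := by
  intro x hx hx0
  have h := hJ.pos x hx0
  rw [Module.End.mem_eigenspace_iff] at hx
  rwa [hx, sesq_smul_right, Complex.I_mul_im] at h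

/-- `H` is negative definite on `ker(J + i)`: `E(x, Jx) = E(x, -ix) = -Re H(x, x)`.
[cite: vanGeemen1994HodgeAV, 5.6–5.7] -/
theorem isNegDefOn_eigenspace_neg (hJ : IsWeilComplexStructure H J) :
    IsNegDefOn H (Module.End.eigenspace J (-Complex.I)) := by
  intro x hx hx0
  have h := hJ.pos x hx0
  rw [Module.End.mem_eigenspace_iff] at hx
  rw [hx, sesq_smul_right, neg_mul, Complex.neg_im, Complex.I_mul_im] at h
  linarith

/-- **`ker(J - i)^⊥ = ker(J + i)`**. [cite: vanGeemen1994HodgeAV, 5.5–5.7] -/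
theorem orthogonalBilin_eigenspace (hJ : IsWeilComplexStructure H J) :
    Submodule.orthogonalBilin H (Module.End.eigenspace J Complex.I) =
      Module.End.eigenspace J (-Complex.I) := by
  apply le_antisymm
  · intro v hv
    have hvm : (2⁻¹ : ℂ) • (v + Complex.I • J v) ∈
        Submodule.orthogonalBilin H (Module.End.eigenspace J Complex.I) :=
      Submodule.mem_orthogonalBilin_iff.2 fun x hx =>
        hJ.apply_eq_zero_of_mem_eigenspace hx (hJ.half_add_mem_eigenspace_neg v)
    have hvp : (2⁻¹ : ℂ) • (v - Complex.I • J v) ∈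
        Submodule.orthogonalBilin H (Module.End.eigenspace J Complex.I) := by
      have h' := sub_mem hv hvm
      have heq : v - (2⁻¹ : ℂ) • (v + Complex.I • J v) = (2⁻¹ : ℂ) • (v - Complex.I • J v) := by
        module
      rwa [heq] at h'
    have hp0 : (2⁻¹ : ℂ) • (v - Complex.I • J v) = 0 := by
      by_contra hne
      have hpos := hJ.isPosDefOn_eigenspace _ (hJ.half_sub_mem_eigenspace v) hne
      rw [apply_eq_zero_of_mem_of_mem_orthogonalBilin H (hJ.half_sub_mem_eigenspace v) hvp,
        Complex.zero_re] at hpos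
      exact lt_irrefl _ hpos
    rw [← half_sub_add_half_add J v, hp0, zero_add]
    exact hJ.half_add_mem_eigenspace_neg v
  · intro y hy
    exact Submodule.mem_orthogonalBilin_iff.2 fun x hx => hJ.apply_eq_zero_of_mem_eigenspace hx hy

/-- **A complex structure of Weil type polarizes its `i`-eigenspace**: `W := ker(J - i)` is a
polarizing plane. [cite: vanGeemen1994HodgeAV, 5.5–5.7] -/
theorem isPolarizingPlane_eigenspace (hJ : IsWeilComplexStructure H J) :
    IsPolarizingPlane H (Module.End.eigenspace J Complex.I) :=
  ⟨hJ.isPosDefOn_eigenspace, hJ.orthogonalBilin_eigenspace ▸ hJ.isNegDefOn_eigenspace_neg⟩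

/-- **… and is recovered from it**: `J = J_W` for `W = ker(J - i)`.
[cite: vanGeemen1994HodgeAV, 5.3 and 5.5–5.7] -/
theorem complexStructureOfPlane_eigenspace (hJ : IsWeilComplexStructure H J)
    (h : IsCompl (Module.End.eigenspace J Complex.I)
      (Submodule.orthogonalBilin H (Module.End.eigenspace J Complex.I))) :
    complexStructureOfPlane (Module.End.eigenspace J Complex.I) h = J := by
  ext x
  have hp : J (weilPlusPart h x) = Complex.I • weilPlusPart h x :=
    Module.End.mem_eigenspace_iff.1 (weilPlusPart_mem h x)
  have hn : J (weilMinusPart h x) = (-Complex.I) • weilMinusPart h x := by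
    have hm := weilMinusPart_mem h x
    rw [hJ.orthogonalBilin_eigenspace] at hm
    exact Module.End.mem_eigenspace_iff.1 hm
  conv_rhs => rw [← weilPlusPart_add_weilMinusPart h x, map_add, hp, hn]
  rw [complexStructureOfPlane_apply, neg_smul, sub_eq_add_neg]

end IsWeilComplexStructure

/-! ### Deligne's `X⁺` = van Geemen's `H_n` -/

/-- **Complex structures of Weil type ≃ polarizing planes**, `J ↦ ker(J - i)`, `W ↦ J_W`
(`V` finite-dimensional, `H` Hermitian). Deligne's domain `X⁺` of `E`-compatible positive
`K`-linear complex structures is van Geemen's Grassmannian model `{V₊ : H|_{V₊} > 0}`.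
[cite: vanGeemen1994HodgeAV, 5.5–5.8] [cite: Deligne1982HodgeCycles, proof of Thm. 4.8, p. 49] -/
def weilComplexStructureEquiv [FiniteDimensional ℂ V] (hH : H.IsSymm) :
    {J : V →ₗ[ℂ] V // IsWeilComplexStructure H J} ≃ {W : Submodule ℂ V // IsPolarizingPlane H W} where
  toFun J := ⟨Module.End.eigenspace J.1 Complex.I, J.2.isPolarizingPlane_eigenspace⟩
  invFun W := ⟨complexStructureOfPlane W.1 (isCompl_orthogonalBilin_of_isPosDefOn W.2.1),
    isWeilComplexStructure_complexStructureOfPlane _ hH W.2⟩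
  left_inv J := Subtype.ext (J.2.complexStructureOfPlane_eigenspace _)
  right_inv _ := Subtype.ext (eigenspace_complexStructureOfPlane _)

/-- The value of the equivalence is the `i`-eigenspace. [cite: vanGeemen1994HodgeAV, 5.7] -/
@[simp]
theorem coe_weilComplexStructureEquiv_apply [FiniteDimensional ℂ V] (hH : H.IsSymm)
    (J : {J : V →ₗ[ℂ] V // IsWeilComplexStructure H J}) :
    ((weilComplexStructureEquiv hH J : {W : Submodule ℂ V // IsPolarizingPlane H W}) :
        Submodule ℂ V) = Module.End.eigenspace J.1 Complex.I :=
  rfl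

/-- The inverse of the equivalence is van Geemen's `J_{V₊}`. [cite: vanGeemen1994HodgeAV, 5.5] -/
@[simp]
theorem coe_weilComplexStructureEquiv_symm_apply [FiniteDimensional ℂ V] (hH : H.IsSymm)
    (W : {W : Submodule ℂ V // IsPolarizingPlane H W}) :
    ((weilComplexStructureEquiv hH).symm W : V →ₗ[ℂ] V) =
      complexStructureOfPlane W.1 (isCompl_orthogonalBilin_of_isPosDefOn W.2.1) :=
  rfl

end Literature.AlgebraicGeometry.Motives

end
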